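import Mathlib
import HarnessLib
import Summits.ResolutionOfSingularities.ResolutionOfSingularities.Theorems.HomologicalConductorNoZenoStableEnd

/-!
# Crux `NoZenoR` (stmt-ResolutionOfSingularities-19943), kill test `SurfaceTermination` (stmt-16488) —
# PROPOSITION G, first half: the `r × r` MIXED MINORS `det(φ_i(m_j))` of a torsion-free module of rank `≤ r`
# STABLY ANNIHILATE it (`I_r(M) ⊆ 𝔰(M)`)

Route `ResolutionOfSingularities/HomologicalConductor`, crux chain W4.4 (PROP G of lead g23, KERNEL-g23 §2½ / CHAIN (T23-9′),
refereed by the desk DW145 (3); typed by lead g24, KERNEL-g24 §2).  `[OURS]` — AI-formalised, weaker than expert review; NOT a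
statement of the manuscript under review (Hironaka 2017).  Pure linear algebra over a commutative ring against the tree's
stable-category vocabulary `projFactoring` / `StablyAnnihilates` (`…Theorems.NoZeno.SandwichCluster`, p-ids of record in
`…NoZenoStableEnd.lean`); no resolution or cohomology-annihilator object is used.

THE DETERMINANT TRICK.  Given linear forms `φ_1,…,φ_r ∈ M*` and elements `m_1,…,m_r ∈ M`, put `Φ : M → T^r`, `x ↦ (φ_i x)_i`,
`Ψ : T^r → M`, `c ↦ Σ c_j m_j`, and `G := Φ ∘ Ψ = (φ_i(m_j))_{ij} ∈ M_r(T)`.  Then `θ := Ψ ∘ adj(G) ∘ Φ : M → M` factors through the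
finite free module `T^r` (`theta_mem_projFactoring`) and `Φ ∘ θ = det G · Φ` (`pi_comp_theta`).  Hence, whenever `Φ` is injective,
`det G · 1_M = θ ∈ P(M, M)`, i.e. `det G ∈ 𝔰(M)` (`det_smul_id_mem_projFactoring_of_injective`).  Injectivity of `Φ` holds as soon as
`M` is torsion-free, every `r + 1` elements of `M` are linearly dependent (rank `≤ r`) and `det G` is a non-zero-divisor
(`injective_pi_of_forall_not_linearIndependent`: a relation `a·x + Σ c_j m_j = 0` with `Φ x = 0` gives `G c = 0`, so
`det G · c = 0`, `c = 0`, `a x = 0`, `x = 0`).  Consequence (`det_stablyAnnihilates`): **for `M` torsion-free of rank `≤ r`, every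
`r × r` mixed minor `det(φ_i(m_j))` stably annihilates `M`** — PROP G (i) `I_r(M) ⊆ 𝔰(M)`; with `𝔰(M) = I_{A_M⁺}` (THEOREM 23-S∞) this
is the inequality `D ≥ A` of the desk's `B_σ`-test (COR G1), which is therefore a theorem and not a falsifier.
-/

noncomputable section

-- single-problem summit: the doubled namespace component `ResolutionOfSingularities` is forced
set_option linter.dupNamespace false

namespace Summit.ResolutionOfSingularities.ResolutionOfSingularities.Theorems.NoZeno.MinorsStablyAnnihilate

open Matrix
open Summit.ResolutionOfSingularities.ResolutionOfSingularities.Theorems.NoZeno.SandwichCluster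

universe u

variable {T : Type u} [CommRing T] {M : Type u} [AddCommGroup M] [Module T M]
variable {ι : Type} [Fintype ι] [DecidableEq ι]

/-! ## The determinant trick -/

/-- `Φ ∘ Ψ = G`: evaluating the forms `φ_i` on a combination `Σ c_j m_j` is multiplying `c` by the matrix `G = (φ_i(m_j))`.
[folklore] -/
theorem pi_comp_linearCombination (φ : ι → (M →ₗ[T] T)) (m : ι → M) :
    (LinearMap.pi φ) ∘ₗ (Fintype.linearCombination T m) =
      (Matrix.of fun i j => φ i (m j)).mulVecLin := by
  ext c i
  simp only [LinearMap.coe_comp, Function.comp_apply, LinearMap.pi_apply, Fintype.linearCombination_apply,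
    map_sum, map_smul, smul_eq_mul, Matrix.mulVecLin_apply, Matrix.mulVec, dotProduct, Matrix.of_apply]
  exact Finset.sum_congr rfl fun j _ => mul_comm _ _

/-- `θ := Ψ ∘ adj(G) ∘ Φ` factors through the finite free module `T^ι`, hence lies in `P(M, M)`. [folklore] -/
theorem theta_mem_projFactoring (φ : ι → (M →ₗ[T] T)) (m : ι → M) :
    (Fintype.linearCombination T m) ∘ₗ (Matrix.of fun i j => φ i (m j)).adjugate.mulVecLin ∘ₗ
        (LinearMap.pi φ) ∈ projFactoring T M M := by
  rw [← LinearMap.comp_assoc]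
  exact comp_mem_projFactoring _ _

/-- `Φ ∘ θ = det G · Φ`: `Φ Ψ adj(G) Φ = G adj(G) Φ = det G · Φ`. [folklore] -/
theorem pi_comp_theta (φ : ι → (M →ₗ[T] T)) (m : ι → M) :
    (LinearMap.pi φ) ∘ₗ ((Fintype.linearCombination T m) ∘ₗ
        (Matrix.of fun i j => φ i (m j)).adjugate.mulVecLin ∘ₗ (LinearMap.pi φ)) =
      (Matrix.of fun i j => φ i (m j)).det • LinearMap.pi φ := by
  rw [← LinearMap.comp_assoc, ← LinearMap.comp_assoc, pi_comp_linearCombination]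
  ext x i
  simp only [LinearMap.coe_comp, Function.comp_apply, Matrix.mulVecLin_apply, Matrix.mulVec_mulVec,
    Matrix.mul_adjugate, Matrix.smul_mulVec, Matrix.one_mulVec, LinearMap.smul_apply, Pi.smul_apply]

/-- **The determinant trick.** If `Φ = (φ_i)_i : M → T^ι` is injective then `det(φ_i(m_j)) · 1_M = Ψ ∘ adj(G) ∘ Φ ∈ P(M, M)`:
the mixed minor stably annihilates `M`. [this work; KERNEL-g23 PROP G (i)] -/
theorem det_smul_id_mem_projFactoring_of_injective (φ : ι → (M →ₗ[T] T)) (m : ι → M)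
    (hinj : Function.Injective (LinearMap.pi φ)) :
    (Matrix.of fun i j => φ i (m j)).det • (LinearMap.id : M →ₗ[T] M) ∈ projFactoring T M M := by
  have hθ := theta_mem_projFactoring φ m
  have heq : (Fintype.linearCombination T m) ∘ₗ (Matrix.of fun i j => φ i (m j)).adjugate.mulVecLin ∘ₗ
      (LinearMap.pi φ) = (Matrix.of fun i j => φ i (m j)).det • (LinearMap.id : M →ₗ[T] M) := by
    apply LinearMap.ext
    intro x
    apply hinj
    have h := LinearMap.congr_fun (pi_comp_theta φ m) x
    simp only [LinearMap.coe_comp, Function.comp_apply, LinearMap.smul_apply] at h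
    simp only [LinearMap.coe_comp, Function.comp_apply, LinearMap.smul_apply, LinearMap.id_coe, id_eq,
      map_smul]
    exact h
  rwa [heq] at hθ

/-! ## Injectivity of `Φ` from torsion-freeness and rank -/

/-- `G c = 0 ⇒ det G · c = 0` (multiply by the adjugate). [folklore] -/
theorem det_smul_eq_zero_of_mulVec_eq_zero {G : Matrix ι ι T} {c : ι → T} (h : G *ᵥ c = 0) :
    G.det • c = 0 := by
  have := congrArg (fun v => G.adjugate *ᵥ v) h
  simpa only [Matrix.mulVec_mulVec, Matrix.adjugate_mul, Matrix.smul_mulVec, Matrix.one_mulVec,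
    Matrix.mulVec_zero] using this

/-- **Injectivity of `Φ`.** If `M` is torsion-free, every family `Option ι → M` (i.e. any `r + 1` elements) is linearly
dependent, and `det(φ_i(m_j))` is a non-zero-divisor, then `Φ = (φ_i)_i : M → T^ι` is injective.  [this work] -/
theorem injective_pi_of_forall_not_linearIndependent [NoZeroSMulDivisors T M] (φ : ι → (M →ₗ[T] T)) (m : ι → M)
    (hdep : ∀ v : Option ι → M, ¬ LinearIndependent T v)
    (hdet : (Matrix.of fun i j => φ i (m j)).det ∈ nonZeroDivisors T) :
    Function.Injective (LinearMap.pi φ) := by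
  classical
  rw [injective_iff_map_eq_zero]
  intro x hx
  -- a non-trivial relation among `x, m_1, …, m_r`
  obtain ⟨g, hg, i₀, hi₀⟩ := Fintype.not_linearIndependent_iff.mp (hdep fun o => Option.elim o x m)
  rw [Fintype.sum_option] at hg
  simp only [Option.elim_none, Option.elim_some] at hg
  -- apply `φ_i`: `G c = 0` with `c := g ∘ some`
  set c : ι → T := fun j => g (some j) with hc
  have hGc : (Matrix.of fun i j => φ i (m j)) *ᵥ c = 0 := by
    funext i
    have hφx : φ i x = 0 := by
      have := congrFun hx i
      simpa [LinearMap.pi_apply] using this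
    have := congrArg (φ i) hg
    simp only [map_add, map_smul, map_sum, smul_eq_mul, hφx, mul_zero, zero_add, map_zero] at this
    simp only [Matrix.mulVec, dotProduct, Matrix.of_apply, Pi.zero_apply, hc]
    rw [← this]
    exact Finset.sum_congr rfl fun j _ => mul_comm _ _
  -- hence `c = 0`
  have hc0 : ∀ j, c j = 0 := fun j => by
    have hj := congrFun (det_smul_eq_zero_of_mulVec_eq_zero hGc) j
    simp only [Pi.smul_apply, smul_eq_mul, Pi.zero_apply] at hj
    exact (mem_nonZeroDivisors_iff_left.mp hdet) _ hj
  have hgs : ∀ j, g (some j) = 0 := hc0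
  -- the coefficient of `x` is non-zero, and `M` is torsion-free
  have hnone : g none ≠ 0 := by
    rcases i₀ with _ | j
    · exact hi₀
    · exact absurd (hgs j) hi₀
  have hx0 : g none • x = 0 := by simpa [hgs] using hg
  exact (NoZeroSMulDivisors.eq_zero_or_eq_zero_of_smul_eq_zero hx0).resolve_left hnone

omit [DecidableEq ι] in
/-- Rank form of the dependence hypothesis: if `Module.rank T M ≤ r = |ι|` then any family indexed by `Option ι`
(`r + 1` elements) is linearly dependent. [folklore] -/
theorem forall_not_linearIndependent_of_rank_le [Nontrivial T] (hrank : Module.rank T M ≤ Fintype.card ι)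
    (v : Option ι → M) : ¬ LinearIndependent T v := by
  intro hv
  have h1 := hv.cardinal_lift_le_rank
  rw [Cardinal.mk_fintype, Fintype.card_option, Cardinal.lift_natCast] at h1
  have h2 : Cardinal.lift.{0, u} (Module.rank T M) ≤ Cardinal.lift.{0, u} (Fintype.card ι : Cardinal.{u}) :=
    Cardinal.lift_le.mpr hrank
  rw [Cardinal.lift_natCast] at h2
  have h := h1.trans h2
  norm_cast at h
  omega

/-! ## PROPOSITION G (i): mixed minors stably annihilate -/

/-- **PROP G (i), abstract form.** `M` torsion-free, every `r + 1` elements linearly dependent, `det(φ_i(m_j))` a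
non-zero-divisor ⇒ `det(φ_i(m_j)) · 1_M ∈ P(M, M)`. [this work; KERNEL-g23 PROP G (i)] -/
theorem det_smul_id_mem_projFactoring [NoZeroSMulDivisors T M] (φ : ι → (M →ₗ[T] T)) (m : ι → M)
    (hdep : ∀ v : Option ι → M, ¬ LinearIndependent T v)
    (hdet : (Matrix.of fun i j => φ i (m j)).det ∈ nonZeroDivisors T) :
    (Matrix.of fun i j => φ i (m j)).det • (LinearMap.id : M →ₗ[T] M) ∈ projFactoring T M M :=
  det_smul_id_mem_projFactoring_of_injective φ m (injective_pi_of_forall_not_linearIndependent φ m hdep hdet)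

/-- **PROP G (i) over a domain**: for `M` torsion-free with every `r + 1` elements dependent (rank `≤ r`), EVERY `r × r` mixed
minor `det(φ_i(m_j))` satisfies `det · 1_M ∈ P(M, M)` (a zero minor trivially). [this work; KERNEL-g23 PROP G (i)] -/
theorem det_smul_id_mem_projFactoring_of_isDomain [IsDomain T] [NoZeroSMulDivisors T M]
    (φ : ι → (M →ₗ[T] T)) (m : ι → M) (hdep : ∀ v : Option ι → M, ¬ LinearIndependent T v) :
    (Matrix.of fun i j => φ i (m j)).det • (LinearMap.id : M →ₗ[T] M) ∈ projFactoring T M M := by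
  by_cases h0 : (Matrix.of fun i j => φ i (m j)).det = 0
  · rw [h0, zero_smul]
    exact zero_mem _
  · exact det_smul_id_mem_projFactoring φ m hdep (mem_nonZeroDivisors_of_ne_zero h0)

/-- **PROP G (i) in the tree's `StablyAnnihilates` vocabulary** (`ModuleCat`, Iyengar–Takahashi Remark 2.13 shape): over a domain,
for `M` torsion-free of rank `≤ r`, every `r × r` mixed minor `det(φ_i(m_j))` STABLY ANNIHILATES `M` — hence kills
`Ext^{≥1}(M, −)` (`StablyAnnihilates.smul_ext_eq_zero`). [this work; KERNEL-g23 PROP G (i)] -/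
theorem det_stablyAnnihilates [IsDomain T] [NoZeroSMulDivisors T M] (φ : ι → (M →ₗ[T] T)) (m : ι → M)
    (hdep : ∀ v : Option ι → M, ¬ LinearIndependent T v) :
    StablyAnnihilates T (Matrix.of fun i j => φ i (m j)).det (ModuleCat.of T M) :=
  (stablyAnnihilates_iff_smul_id_mem_projFactoring _).mpr (det_smul_id_mem_projFactoring_of_isDomain φ m hdep)

/-- **`I_r(M) ⊆ 𝔰(M)`**: over a domain, for `M` torsion-free of rank `≤ r`, the ideal generated by all `r × r` mixed minors is
contained in the stable annihilator `𝔰(M) = (P(M,M) : 1_M)`. [this work; KERNEL-g23 PROP G (i)] -/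
theorem span_minors_le_colon_projFactoring [IsDomain T] [NoZeroSMulDivisors T M]
    (hdep : ∀ v : Option ι → M, ¬ LinearIndependent T v) :
    Ideal.span {d : T | ∃ (φ : ι → (M →ₗ[T] T)) (m : ι → M), d = (Matrix.of fun i j => φ i (m j)).det} ≤
      (projFactoring T M M).colon {(LinearMap.id : M →ₗ[T] M)} := by
  refine Ideal.span_le.mpr ?_
  rintro d ⟨φ, m, rfl⟩
  rw [SetLike.mem_coe, Submodule.mem_colon_singleton]
  exact det_smul_id_mem_projFactoring_of_isDomain φ m hdep

/-- The same with the rank hypothesis `Module.rank T M ≤ r`. [this work] -/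
theorem det_stablyAnnihilates_of_rank_le [IsDomain T] [NoZeroSMulDivisors T M] (φ : ι → (M →ₗ[T] T)) (m : ι → M)
    (hrank : Module.rank T M ≤ Fintype.card ι) :
    StablyAnnihilates T (Matrix.of fun i j => φ i (m j)).det (ModuleCat.of T M) :=
  det_stablyAnnihilates φ m (forall_not_linearIndependent_of_rank_le hrank)

end Summit.ResolutionOfSingularities.ResolutionOfSingularities.Theorems.NoZeno.MinorsStablyAnnihilate

end
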